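import Summits.BirchSwinnertonDyer.BirchSwinnertonDyer.Theorems.PrintCf2SplitBadTwoRestrictedSelmerCokernelBound
import Literature.NumberTheory.EllipticCurves.BigRepModuleShapiroSelmerConditionsProofs
import HarnessLib

/-!
# Crux `PrintCf2.SplitBadTwoRankOneOfFacts` (stmt-BirchSwinnertonDyer-20368), road α v9.1 — S3c₂ piece (iv)-b:
# the ARCHIMEDEAN local kernels vanish for a totally complex `K` (every frame field), so the cokernel bound of p658316 needs
# only the finite local kernels at `w ∣ 7d` and at `v̄`

Cell `bsd-print-cf2`, LEAD seat `bsd-line-cf2-p1` g11 (prover-bsd-line-cf2-p1-g11-0); `--supports stmt-BirchSwinnertonDyer-20368` (helper,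
Theses-free). HONEST FRAMING: nothing here closes the crux or a registered stub; BSD is not proved by any of this; no summit statement is
proved by this seat. No definition, no named fact, no `sorry`.

p658316 `relIndex_le_prod_natCard_localKer` bounds the cokernel index of S3c₂'s four-index identity by the product of the local kernels
`LK_w = ker (H¹(⊤ ∩ D_w, M) → H¹(Gal(K̄/K_∞) ∩ D_w, M))` under the hypothesis `hinf` that the archimedean ones vanish. For an imaginary
quadratic (indeed any totally complex) `K` this is automatic: at a complex place `D_w = 1` (`decompInf_eq_bot_of_isComplex`, Greenberg
§3 p. 87 "archimedean primes split completely"), so `H¹(⊤ ∩ D_w, M) = H¹(1, M) = 0`: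
* `subgroupH1_eq_zero_of_le_bot` (a class on a trivial group is `0`), `localKer_decompInf_eq_bot_of_isComplex`,
  `localKer_decompInf_eq_bot_of_isImaginaryQuadratic`;
* **`relIndex_le_prod_natCard_localKer_of_isImaginaryQuadratic`** — p658316 with `hinf` DISCHARGED: for every S3c₂ frame field (indeed any
  imaginary quadratic `K`), `[𝔖_𝔮(K_∞, M)^Γ : res 𝔖_𝔮(K, M)] ≤ (∏_{w ∈ T} #LK_w) · #LK_𝔮` as soon as the finite local kernels vanish off `T`
  (B16, good places) and are finite on `T` and at `𝔮` (B16 at `w ∣ 7d`, B15 at `v̄`).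
presearch: Greenberg LNM 1716 §3 p. 87 — held; no fact filed.

References: [GreenbergLNM1716] §3 p. 87 and Lemmas 3.2–3.3; [SerreGaloisCohomology1997] I §2.3.
-/

noncomputable section

open scoped Classical

set_option linter.dupNamespace false
set_option autoImplicit false

open NumberField IsDedekindDomain Field
open Literature.NumberTheory.EllipticCurves Literature.NumberTheory.EllipticCurves.GreenbergSelmer
open Literature.NumberTheory.EllipticCurves.Agboola2007
open Literature.NumberTheory.EllipticCurves.IwasawaDual
open Literature.NumberTheory.EllipticCurves.ResKernel
open Literature.NumberTheory.GaloisRepresentations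

universe u

namespace Summit.BirchSwinnertonDyer.BirchSwinnertonDyer.Theorems.PrintCf2.RestrictedSelmerPair

section Arch

variable {K : Type u} [Field K] [NumberField K] {p : ℕ} [Fact p.Prime] (κ : ZpExtension K p)
  (M : Type u) [AddCommGroup M] [DistribMulAction (absoluteGaloisGroup K) M]
  [TopologicalSpace M] [DiscreteTopology M]

omit [NumberField K] [Fact p.Prime] in
/-- `H¹(H, M) = 0` for a subgroup `H ≤ ⊥` (a crossed homomorphism vanishes at `1`). [cite: SerreGaloisCohomology1997, I §2.3] -/
theorem subgroupH1_eq_zero_of_le_bot {H : Subgroup (absoluteGaloisGroup K)} (hH : H ≤ ⊥)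
    (x : subgroupH1 H M) : x = 0 := by
  obtain ⟨φ, rfl⟩ := oneCocycleClass_surjective _ x
  have h1 : ∀ σ : H, σ = 1 := fun σ ↦ Subtype.ext (Subgroup.mem_bot.mp (hH σ.2))
  have hφ : φ = 0 := by
    apply Subtype.ext
    ext σ
    rw [h1 σ]
    exact contOneCocycles.apply_one φ
  rw [hφ]
  exact oneCocycleClass_zero _

omit [NumberField K] in
/-- **At a complex place the archimedean local kernel vanishes** (indeed all of `H¹(⊤ ∩ D_w, M)` does: `D_w = ⊥`,
`decompInf_eq_bot_of_isComplex`). [cite: GreenbergLNM1716, §3 p. 87 (archimedean primes split completely)] -/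
theorem localKer_decompInf_eq_bot_of_isComplex {w : InfinitePlace K} (hw : w.IsComplex) :
    (resOfLe M (inf_le_inf_right (decompInf w) (le_top : κ.kerSubgroup ≤ ⊤))).ker = ⊥ := by
  rw [eq_bot_iff]
  intro x _
  rw [AddSubgroup.mem_bot]
  have hle : (⊤ : Subgroup (absoluteGaloisGroup K)) ⊓ decompInf w ≤ ⊥ := by
    rw [BigGaloisRep.decompInf_eq_bot_of_isComplex hw, inf_bot_eq]
  exact subgroupH1_eq_zero_of_le_bot M hle x

/-- **For an imaginary quadratic (hence totally complex) `K`, every archimedean local kernel vanishes** — the hypothesis `hinf` of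
`relIndex_le_prod_natCard_localKer` on every S3c₂ frame field. [cite: GreenbergLNM1716, §3 p. 87] -/
theorem localKer_decompInf_eq_bot_of_isImaginaryQuadratic (hK : IsImaginaryQuadratic K) (w : InfinitePlace K) :
    (resOfLe M (inf_le_inf_right (decompInf w) (le_top : κ.kerSubgroup ≤ ⊤))).ker = ⊥ :=
  localKer_decompInf_eq_bot_of_isComplex κ M (hK.2.isComplex w)

/-- **THE COKERNEL BOUND ON AN IMAGINARY QUADRATIC BASE** (every S3c₂ frame field): p658316 with the archimedean hypothesis discharged —
`[𝔖_𝔮(K_∞, M)^Γ : res 𝔖_𝔮(K, M)] ≤ (∏_{w ∈ T} #LK_w) · #LK_𝔮` whenever the FINITE local kernels vanish at the finite `w ∤ p` off `T`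
and are finite on `T` and at `𝔮`. [cite: GreenbergLNM1716, §3 Lemmas 3.2–3.3 (pp. 86–88)] [cite: Agboola2007, §3 Prop. 3.2] -/
theorem relIndex_le_prod_natCard_localKer_of_isImaginaryQuadratic (hK : IsImaginaryQuadratic K)
    (𝔮 : HeightOneSpectrum (𝓞 K)) {γ : absoluteGaloisGroup K} (hγ : κ.IsTopGenerator γ)
    (hcont : ∀ m : M, Continuous fun g : absoluteGaloisGroup K ↦ g • m) (hprim : ∀ m : M, ∃ k : ℕ, p ^ k • m = 0)
    (T : Finset (HeightOneSpectrum (𝓞 K))) (hTp : ∀ w ∈ T, ((p : ℕ) : 𝓞 K) ∉ w.asIdeal)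
    (hT0 : ∀ w : HeightOneSpectrum (𝓞 K), ((p : ℕ) : 𝓞 K) ∉ w.asIdeal → w ∉ T →
      (resOfLe M (inf_le_inf_right (decomp w) (le_top : κ.kerSubgroup ≤ ⊤))).ker = ⊥)
    (hfinT : ∀ w ∈ T, Finite (resOfLe M (inf_le_inf_right (decomp w) (le_top : κ.kerSubgroup ≤ ⊤))).ker)
    (hfinq : Finite (resOfLe M (inf_le_inf_right (decomp 𝔮) (le_top : κ.kerSubgroup ≤ ⊤))).ker) :
    (((restrictedSelmerBase M p 𝔮).map (resOfLe M (le_top : κ.kerSubgroup ≤ ⊤))).addSubgroupOf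
        (restrictedSelmerZp κ M 𝔮)).relIndex (endInvariants (conjRestricted κ M 𝔮 γ - 1)) ≤
      (∏ w ∈ T, Nat.card (resOfLe M (inf_le_inf_right (decomp w) (le_top : κ.kerSubgroup ≤ ⊤))).ker) *
        Nat.card (resOfLe M (inf_le_inf_right (decomp 𝔮) (le_top : κ.kerSubgroup ≤ ⊤))).ker :=
  relIndex_le_prod_natCard_localKer κ M 𝔮 hγ hcont hprim T hTp hT0
    (localKer_decompInf_eq_bot_of_isImaginaryQuadratic κ M hK) hfinT hfinq

end Arch

end Summit.BirchSwinnertonDyer.BirchSwinnertonDyer.Theorems.PrintCf2.RestrictedSelmerPair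

end
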